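import Summits.ResolutionOfSingularities.ResolutionOfSingularities.Theses.WildPurity
import Literature.AlgebraicGeometry.Resolution.ProjectiveSpaceRegular

/-!
# `PurityTransfer` (crux stmt-ResolutionOfSingularities-17142, route `WildPurity`) — negative side,
# file 1/5: DEFINITIONS of the residue technology (refuter `cdisprove` seat; nothing here refutes the crux)

`WildPurity.PurityTransfer` says: for `p` prime, `k` perfect of characteristic `p`, `K/k` finitely
generated, `O ⊇ k` a valuation ring of `K` and `R ⊆ O` a finitely generated `k`-subalgebra with
`Frac R = K` and `HasResolution (Spec R)`, every class `α` of the SYMBOLIC Kato group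
`H³_p(K) = G ⧸ N` (generators `[a, b, c}`, Kato's seven relation families) that is `W`-integral at
every divisorial place `W ⊇ R` of `K/k` centred inside the centre of `O` is `O`-integral.

Every NEGATIVE statement about this crux (`Unr O ≠ ⊤`, `G ⧸ N ≠ 0`, "false without hypothesis H",
and equally a `WildSymbol` witness `α ∉ Unr O`) needs a HOMOMORPHISM OUT OF `G ⧸ N` compatible with
all seven relation families — a residue map (decoupled functionals `λ(a)·ω(b,c)` are forced to `0`
by the family `[b,b,c} = 0`). This file DEFINES the smallest genuine one; the four sequel files
(`ResidueDeriv`, `ResidueCartier`, `ResidueFunctional`, `FalseWithoutLe`) prove its properties and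
use it to show that the binder `R ⊆ O` of the crux is load-bearing.

## Contents (definitions, with the few lemmas their well-definedness needs)
* `twist θ`, `D e θ` — twisted coordinate derivations on Hahn series `R⟦Γ⟧`
  (`(D x)_g = θ(g-e)·x_{g-e}`), `dlog` — logarithmic derivative;
* `dbl ℓ₀ γ = 2γ - ℓ₀`, `halve ℓ₀` — the Cartier-type halving operator `(halve f)_γ = f_{2γ-ℓ₀}`;
* `Γ₂ = ℤ ×ₗ ℤ`, `H = 𝔽₂((Γ₂))` (expansion of `𝔽₂(x,y)` at infinity, `y ≫ x`), the monomials
  `XH = x`, `YH = y`, their exponents `gx, gy`, the shifts `ex, ey` and characters `θx, θy` of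
  `∂/∂x = D ex θx`, `∂/∂y = D ey θy`, the residue exponent `ℓ₀` (of `x⁻¹y⁻¹`), the Jacobian `J`
  and `G(b,c)` = the coefficient of `dlog b ∧ dlog c` against `dx ∧ dy`;
* `Poly = 𝔽₂[x,y]`, `K = Frac Poly = 𝔽₂(x,y)`, the embeddings `ιP : Poly → H`, `ιK : K → H`,
  `x, y ∈ K` (`xK, yK`, units `xU, yU`);
* `katoRel p L`, `unr p L T` — the crux's `let N`, `let Unr` VERBATIM (so results transfer to the
  crux's `let`-form by `intro`), `Φ₀`, `Φ₁` — the residue on symbols / on the free abelian group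
  (`Φ[a,b,c} = (ιK a · G(ιK b, ιK c))_{ℓ₀}`);
* `O` — the valuation ring of the monomial valuation at infinity (leading exponent `≥ 0`);
  `R = 𝔽₂[x,y] ⊆ K` as an `𝔽₂`-subalgebra, `Frac R = K` (`isFractionRing_R`), `R` regular
  (`isRegularRing_R`, from Mathlib's regularity of polynomial rings).

Sources: K. Kato (1982) §1 [cite: Kato1982, §1]; S. Bloch–K. Kato (1986) Lemma 4.2
[cite: BlochKato1986, Lemma 4.2]; the Cartier operator (Cartier 1957) [folklore].
-/

noncomputable section

-- single-problem summit: the doubled namespace component `ResolutionOfSingularities` is forced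
set_option linter.dupNamespace false

open Finset

namespace Summit.ResolutionOfSingularities.ResolutionOfSingularities.Theorems.PurityTransfer.Negative

/-! ## Twisted coordinate derivations on Hahn series (generic value group and coefficients) -/

section Generic

variable {Γ : Type*} [AddCommGroup Γ] [LinearOrder Γ]
variable {R : Type*} [CommRing R]

/-- coefficientwise twist by an additive character `θ : Γ →+ R`. -/
def twist (θ : Γ →+ R) (x : HahnSeries Γ R) : HahnSeries Γ R where
  coeff g := θ g * x.coeff g
  isPWO_support' := x.isPWO_support.mono (by
    intro g hg
    simp only [Function.mem_support, ne_eq] at hg ⊢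
    intro h
    exact hg (by rw [h, mul_zero]))

variable [IsOrderedAddMonoid Γ]

/-- The twisted coordinate derivation `D_{e,θ} x = single e 1 * twist θ x`:
`(D x).coeff g = θ (g - e) * x.coeff (g - e)`. -/
def D (e : Γ) (θ : Γ →+ R) (x : HahnSeries Γ R) : HahnSeries Γ R :=
  HahnSeries.single e (1 : R) * twist θ x

section Field

variable {F : Type*} [Field F]

/-- logarithmic derivative -/
def dlog (e : Γ) (θ : Γ →+ F) (x : HahnSeries Γ F) : HahnSeries Γ F := D e θ x * x⁻¹

end Field

end Generic

/-! ## The halving operator (generic value group) -/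

section Halving

variable {Γ : Type*} [AddCommGroup Γ] [LinearOrder Γ] [IsOrderedAddMonoid Γ]

/-- the index map of the halving operator: `γ ↦ 2γ - ℓ₀`. -/
def dbl (ℓ₀ : Γ) (γ : Γ) : Γ := γ + γ - ℓ₀

/-- `γ ↦ 2γ - ℓ₀` is strictly monotone. -/
theorem dbl_strictMono (ℓ₀ : Γ) : StrictMono (dbl ℓ₀) := fun a b h => by
  unfold dbl; exact sub_lt_sub_right (add_lt_add h h) ℓ₀

omit [AddCommGroup Γ] [IsOrderedAddMonoid Γ] in
/-- the preimage of a partially well-ordered subset of a linear order under a strictly monotone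
map is partially well-ordered. -/
theorem isPWO_preimage_of_strictMono {s : Set Γ} (hs : s.IsPWO) {φ : Γ → Γ} (hφ : StrictMono φ) :
    (φ ⁻¹' s).IsPWO := by
  rw [Set.isPWO_iff_isWF, Set.isWF_iff_no_descending_seq] at hs ⊢
  intro g hg hmem
  exact hs (φ ∘ g) (hφ.comp_strictAnti hg) (fun n => hmem n)

variable {R : Type*} [CommRing R]

/-- The halving operator `(halve ℓ₀ f).coeff γ = f.coeff (2γ - ℓ₀)` (a Cartier-type operator:
it extracts the coefficients in the coset `2Γ - ℓ₀`). -/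
def halve (ℓ₀ : Γ) (f : HahnSeries Γ R) : HahnSeries Γ R where
  coeff γ := f.coeff (dbl ℓ₀ γ)
  isPWO_support' := isPWO_preimage_of_strictMono f.isPWO_support (dbl_strictMono ℓ₀)

end Halving

/-! ## The concrete field `H = 𝔽₂((ℤ ×ₗ ℤ))` -/

section Concrete

/-- value group: `toLex (m, n)` is the exponent of the monomial `y^(-m) x^(-n)` (expansion at
infinity: `y` dominates `x`). -/
abbrev Γ₂ : Type := ℤ ×ₗ ℤ
/-- the Hahn-series field `𝔽₂((Γ₂))`. -/
abbrev H : Type := HahnSeries Γ₂ (ZMod 2)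

/-- exponent of `x`. -/
def gx : Γ₂ := toLex ((0 : ℤ), (-1 : ℤ))
/-- exponent of `y`. -/
def gy : Γ₂ := toLex ((-1 : ℤ), (0 : ℤ))
/-- shift of `∂/∂x` (`= -gx`). -/
def ex : Γ₂ := toLex ((0 : ℤ), (1 : ℤ))
/-- shift of `∂/∂y` (`= -gy`). -/
def ey : Γ₂ := toLex ((1 : ℤ), (0 : ℤ))
/-- exponent of `x⁻¹ y⁻¹`, where the residue functional reads its coefficient. -/
def ℓ₀ : Γ₂ := toLex ((1 : ℤ), (1 : ℤ))

/-- the series `x`. -/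
def XH : H := HahnSeries.single gx 1
/-- the series `y`. -/
def YH : H := HahnSeries.single gy 1

/-- character of `∂/∂x`: the `x`-exponent mod 2. -/
def θx : Γ₂ →+ ZMod 2 where
  toFun g := ((ofLex g).2 : ZMod 2)
  map_zero' := by simp
  map_add' a b := by simp

/-- character of `∂/∂y`: the `y`-exponent mod 2. -/
def θy : Γ₂ →+ ZMod 2 where
  toFun g := ((ofLex g).1 : ZMod 2)
  map_zero' := by simp
  map_add' a b := by simp

/-- the Jacobian `J(b,c) = ∂ₓb ∂_y c - ∂_y b ∂ₓ c`. -/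
def J (b c : H) : H := D ex θx b * D ey θy c - D ey θy b * D ex θx c

/-- `G(b,c) = dlogₓ b · dlog_y c - dlog_y b · dlogₓ c`, i.e. `dlog b ∧ dlog c = G dx ∧ dy`. -/
def G (b c : H) : H := dlog ex θx b * dlog ey θy c - dlog ey θy b * dlog ex θx c

/-- `H = 𝔽₂((Γ₂))` has characteristic `2`. -/
instance charP_H : CharP H 2 :=
  charP_of_injective_ringHom (HahnSeries.C_injective (Γ := Γ₂) (R := ZMod 2)) 2

end Concrete

/-! ## The function field `K = 𝔽₂(x,y)`, its embedding into `H`, the symbolic Kato group and the residue -/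

section FunctionField

open MvPolynomial

/-- `𝔽₂[x, y]`. -/
abbrev Poly : Type := MvPolynomial (Fin 2) (ZMod 2)
/-- `K = 𝔽₂(x, y)`. -/
abbrev K : Type := FractionRing Poly

/-- the embedding `𝔽₂[x,y] → H`, `x ↦ x`, `y ↦ y` (expansion at infinity). -/
def ιP : Poly →ₐ[ZMod 2] H := MvPolynomial.aeval ![XH, YH]

/-- exponent of the monomial `x^(s 0) y^(s 1)`. -/
def expo (s : Fin 2 →₀ ℕ) : Γ₂ := toLex (-(s 1 : ℤ), -(s 0 : ℤ))

/-- the exponent map is injective. -/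
theorem expo_injective : Function.Injective expo := by
  intro s t h
  have h1 := congrArg (fun g : Γ₂ => (ofLex g).1) h
  have h2 := congrArg (fun g : Γ₂ => (ofLex g).2) h
  simp only [expo, ofLex_toLex, neg_inj, Nat.cast_inj] at h1 h2
  ext i; fin_cases i
  · exact h2
  · exact h1

/-- the exponent of `x^(s 0) y^(s 1)`. -/
theorem nsmul_gx_add_nsmul_gy (s : Fin 2 →₀ ℕ) : (s 0) • gx + (s 1) • gy = expo s := by
  change toLex ((s 0) • ((0 : ℤ), (-1 : ℤ)) + (s 1) • ((-1 : ℤ), (0 : ℤ))) = toLex (-(s 1 : ℤ), -(s 0 : ℤ))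
  congr 1; ext <;> simp

/-- the embedding sends the monomial `c · x^(s 0) y^(s 1)` to `single (expo s) c`. -/
theorem ιP_monomial (s : Fin 2 →₀ ℕ) (c : ZMod 2) :
    ιP (monomial s c) = HahnSeries.single (expo s) c := by
  rw [ιP, aeval_monomial, Finsupp.prod_fintype _ _ (by simp), Fin.prod_univ_two]
  simp only [Matrix.cons_val_zero, Matrix.cons_val_one, Matrix.cons_val_fin_one, XH, YH,
    HahnSeries.single_pow, one_pow, HahnSeries.single_mul_single, mul_one,
    HahnSeries.algebraMap_apply, HahnSeries.C_apply, Algebra.algebraMap_self, RingHom.id_apply,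
    zero_add, nsmul_gx_add_nsmul_gy]

/-- the coefficient of `ιP P` at the exponent of a monomial is the corresponding coefficient of `P`. -/
theorem coeff_ιP_expo (P : Poly) (s : Fin 2 →₀ ℕ) : (ιP P).coeff (expo s) = coeff s P := by
  classical
  conv_lhs => rw [P.as_sum]
  rw [map_sum, HahnSeries.coeff_sum]
  simp only [ιP_monomial, HahnSeries.coeff_single, expo_injective.eq_iff]
  rw [Finset.sum_ite_eq]
  split_ifs with h
  · rfl
  · exact (notMem_support_iff.mp h).symm

/-- the embedding `𝔽₂[x,y] → H` is injective. -/
theorem ιP_injective : Function.Injective ιP := by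
  intro P Q h
  ext s
  have := congrArg (fun f : H => f.coeff (expo s)) h
  simpa only [coeff_ιP_expo] using this

/-- the field embedding `K = 𝔽₂(x,y) → H`. -/
def ιK : K →+* H := IsFractionRing.lift (g := (ιP : Poly →ₐ[ZMod 2] H).toRingHom) ιP_injective

/-- `ιK` extends `ιP`. -/
theorem ιK_algebraMap (P : Poly) : ιK (algebraMap Poly K P) = ιP P :=
  IsFractionRing.lift_algebraMap (g := (ιP : Poly →ₐ[ZMod 2] H).toRingHom) ιP_injective P

/-- `x ∈ K`. -/
def xK : K := algebraMap Poly K (X 0)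
/-- `y ∈ K`. -/
def yK : K := algebraMap Poly K (X 1)

/-- `x ≠ 0` in `H`. -/
theorem XH_ne_zero : XH ≠ 0 := by
  rw [XH, Ne, HahnSeries.single_eq_zero_iff]; exact one_ne_zero

/-- `y ≠ 0` in `H`. -/
theorem YH_ne_zero : YH ≠ 0 := by
  rw [YH, Ne, HahnSeries.single_eq_zero_iff]; exact one_ne_zero

/-- `ιK x = x`. -/
theorem ιK_xK : ιK xK = XH := by rw [xK, ιK_algebraMap]; simp [ιP]
/-- `ιK y = y`. -/
theorem ιK_yK : ιK yK = YH := by rw [yK, ιK_algebraMap]; simp [ιP]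

/-- `x ≠ 0` in `K`. -/
theorem xK_ne_zero : xK ≠ 0 := by
  intro h; apply XH_ne_zero; rw [← ιK_xK, h, map_zero]

/-- `y ≠ 0` in `K`. -/
theorem yK_ne_zero : yK ≠ 0 := by
  intro h; apply YH_ne_zero; rw [← ιK_yK, h, map_zero]

/-- `x` as a unit of `K`. -/
def xU : Kˣ := Units.mk0 xK xK_ne_zero
/-- `y` as a unit of `K`. -/
def yU : Kˣ := Units.mk0 yK yK_ne_zero

/-- verbatim copy of the crux's `let N` (Kato's relations), for a general `p`. -/
def katoRel (p : ℕ) (L : Type) [Field L] : AddSubgroup (FreeAbelianGroup (L × Lˣ × Lˣ)) :=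
  AddSubgroup.closure { x | (∃ (a a' : L) (b c : Lˣ), x = .of (a + a', b, c) - .of (a, b, c) - .of (a', b, c)) ∨ (∃ (a : L) (b b' c : Lˣ), x = .of (a, b * b', c) - .of (a, b, c) - .of (a, b', c)) ∨ (∃ (a : L) (b c c' : Lˣ), x = .of (a, b, c * c') - .of (a, b, c) - .of (a, b, c')) ∨ (∃ (a : L) (b : Lˣ), x = .of (a, b, b)) ∨ (∃ (b c : Lˣ), x = .of ((b : L), b, c)) ∨ (∃ (b c : Lˣ), x = .of ((c : L), b, c)) ∨ (∃ (a : L) (b c : Lˣ), x = .of (a ^ p - a, b, c)) }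

/-- verbatim copy of the crux's `let Unr`. -/
def unr (p : ℕ) (L : Type) [Field L] (T : Subring L) :
    AddSubgroup (FreeAbelianGroup (L × Lˣ × Lˣ) ⧸ katoRel p L) :=
  AddSubgroup.closure { y | ∃ (a : L) (b c : Lˣ), a ∈ T ∧ (b : L) ∈ T ∧ ((b⁻¹ : Lˣ) : L) ∈ T ∧ (c : L) ∈ T ∧ ((c⁻¹ : Lˣ) : L) ∈ T ∧ y = ((FreeAbelianGroup.of (a, b, c) : FreeAbelianGroup (L × Lˣ × Lˣ)) : FreeAbelianGroup (L × Lˣ × Lˣ) ⧸ katoRel p L) }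

/-- the residue of the symbol `[a, b, c}`: the `x⁻¹y⁻¹`-coefficient of `a · dlog b ∧ dlog c` in the
expansion at infinity. -/
def Φ₀ (t : K × Kˣ × Kˣ) : ZMod 2 := (ιK t.1 * G (ιK (t.2.1 : K)) (ιK (t.2.2 : K))).coeff ℓ₀

/-- the residue on the free abelian group of symbols. -/
def Φ₁ : FreeAbelianGroup (K × Kˣ × Kˣ) →+ ZMod 2 := FreeAbelianGroup.lift Φ₀

/-! ## The monomial valuation ring at infinity and the affine model -/

/-- the leading exponent of an inverse: `orderTop u⁻¹ = - order u`. -/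
theorem orderTop_inv {u : H} (hu : u ≠ 0) : u⁻¹.orderTop = ((-u.order : Γ₂) : WithTop Γ₂) := by
  have hui : u⁻¹ ≠ 0 := inv_ne_zero hu
  have h := HahnSeries.order_mul hu hui
  rw [mul_inv_cancel₀ hu, HahnSeries.order_one] at h
  rw [← HahnSeries.order_eq_orderTop_of_ne_zero hui]
  congr 1
  -- 0 = u.order + u⁻¹.order
  have := h.symm
  exact eq_neg_of_add_eq_zero_right this

/-- **the valuation ring of the monomial (rank-two, `y ≫ x`) valuation at infinity**:
the elements of `K` whose expansion has non-negative leading exponent. -/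
def O : ValuationSubring K where
  carrier := {a | 0 ≤ (ιK a).orderTop}
  mul_mem' {a b} ha hb := by
    simp only [Set.mem_setOf_eq, map_mul] at *
    exact le_trans (add_nonneg ha hb) HahnSeries.orderTop_add_le_mul
  one_mem' := by simp
  add_mem' {a b} ha hb := by
    simp only [Set.mem_setOf_eq, map_add] at *
    exact le_trans (le_min ha hb) (HahnSeries.min_orderTop_le_orderTop_add)
  zero_mem' := by simp
  neg_mem' {a} ha := by
    simp only [Set.mem_setOf_eq, map_neg, HahnSeries.orderTop_neg] at *
    exact ha
  mem_or_inv_mem' a := by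
    by_cases ha : a = 0
    · left; simp [ha]
    have hu : ιK a ≠ 0 := (map_ne_zero ιK).mpr ha
    simp only [Set.mem_setOf_eq, map_inv₀]
    by_cases h : 0 ≤ (ιK a).order
    · left
      rw [← HahnSeries.order_eq_orderTop_of_ne_zero hu]
      exact_mod_cast h
    · right
      rw [orderTop_inv hu]
      have h' : (ιK a).order < 0 := lt_of_not_ge h
      exact_mod_cast (neg_nonneg.mpr h'.le)

/-- `R = 𝔽₂[x, y] ⊆ K`, as an `𝔽₂`-subalgebra. -/
def R : Subalgebra (ZMod 2) K := (IsScalarTower.toAlgHom (ZMod 2) Poly K).range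

/-- membership in `R`: images of polynomials. -/
theorem mem_R_iff (z : K) : z ∈ R ↔ ∃ P : Poly, algebraMap Poly K P = z := by
  simp [R, AlgHom.mem_range]

/-- polynomials lie in `R`. -/
theorem algebraMap_mem_R (P : Poly) : algebraMap Poly K P ∈ R := (mem_R_iff _).mpr ⟨P, rfl⟩

/-- `R ⊆ K` acts faithfully. -/
instance faithfulSMul_R : FaithfulSMul R K :=
  (faithfulSMul_iff_algebraMap_injective R K).mpr Subtype.val_injective

/-- `Frac R = K`. -/
instance isFractionRing_R : IsFractionRing R K := by
  refine IsFractionRing.of_field (R := R) (K := K) fun z => ?_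
  obtain ⟨P, Q, -, rfl⟩ := IsFractionRing.div_surjective (A := Poly) z
  exact ⟨⟨_, algebraMap_mem_R P⟩, ⟨_, algebraMap_mem_R Q⟩, rfl⟩

/-- `𝔽₂[x,y] ≃ R`. -/
def eR : Poly ≃ₐ[ZMod 2] R :=
  AlgEquiv.ofInjective (IsScalarTower.toAlgHom (ZMod 2) Poly K) (IsFractionRing.injective Poly K)

/-- `R ≅ 𝔽₂[x,y]` is a regular ring (Mathlib: polynomial rings over regular rings are regular). -/
instance isRegularRing_R : IsRegularRing R := IsRegularRing.of_ringEquiv (R := Poly) eR.toRingEquiv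

end FunctionField

end Summit.ResolutionOfSingularities.ResolutionOfSingularities.Theorems.PurityTransfer.Negative
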